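import Summits.BirchSwinnertonDyer.BirchSwinnertonDyer.Theorems.PrintX11aUpperNonSurjFiveShallowSector
import Summits.BirchSwinnertonDyer.BirchSwinnertonDyer.Theses.PrintX11a
import HarnessLib

/-!
# Route `PrintX11a`, crux U5 = `Theses.PrintX11a.UpperNonSurjFive` (item stmt-BirchSwinnertonDyer-20614), line of record «gl1cartan5»
# (rev 10): the THREE-CORE cut of U5 BY NAME — glue, exactness, and equivalence with rev 9 modulo the nine print facts

Cell `bsd-print-x11a`, LEAD `cruxlead-stmt-BirchSwinnertonDyer-20614` g5 (`--supports stmt-BirchSwinnertonDyer-20614 --as helper`).  THEOREMS ONLY: no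
definition, no named fact minted, no `sorry`; every theorem is CONDITIONAL on named published facts displayed as hypotheses and ∕ or on the open
residual statements; item 20614 is NOT closed by this file and nothing is asserted about any curve.  BY-NAME sequel of the route-file-free module
`Theorems/PrintX11aUpperNonSurjFiveShallowSector.lean` (same seat), which holds the mathematics (the SHALLOW sector «`p` non-split, `ord_p ∏ c_ℓ ≤ 1`,
`Ш(E)[p] = 0`» closed modulo the nine facts, and the three cores C_exc ∕ C_exp ∕ C_tam); this file only names the route declaration
`Theses.PrintX11a.UpperNonSurjFive` and is therefore the one that imports the route file (as `Theorems/PrintX11aUpperNonSurjFiveCoreResiduals.lean`, p673333, did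
for rev 9).

* §1 `GL1Cartan.upperNonSurjFive_of_unitSector_of_shallow_of_threeCores` — fact-free glue UNIT → SHALLOW → C_exc → C_exp → C_tam ⟹ U5 BY NAME (= the registered
  composition `UpperNonSurjFive_of_hyps` of `Cruxes/UpperNonSurjFive/Lines/gl1cartan5.lean` rev 10), and `GL1Cartan.upperNonSurjFive_of_nineFacts_of_threeCores`
  (eight facts + GZK → C_exc → C_exp → C_tam ⟹ U5: a PLANNER TURNKEY for a glued split of item 20614 into a nine-fact binder + the three cores).
* §2 exactness `GL1Cartan.upperNonSurjFive_iff_unitSector_and_shallow_and_threeCores` (fact-free: U5 ↔ UNIT ∧ SHALLOW ∧ C_exc ∧ C_exp ∧ C_tam), and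
  `GL1Cartan.coreResiduals_of_nineFacts_of_threeCores` (rev 10 ⇒ rev 9 modulo the nine facts; with the fact-free converse `threeCores_of_coreResiduals` of the
  companion module the two cuts are EQUIVALENT modulo the named prints, and rev 10's proved part is strictly larger: the depth-one Tamagawa pairs with
  `Ш(E)[p] = 0` — at `N < 5·10⁵` the seven non-split non-unit census pairs).

CENSUS of the rev-10 cut over the 56 known non-surjective X11a pairs at `p = 5`, `N < 5·10⁵` (tree table `X11aPrintCertificates/RecordsLeafNonSurjN500000Part1–2.lean`):
UNIT 26 · SHALLOW 7 · C_exc 23 · C_exp 0 (+ the 15 main-locus twist pairs of `Cruxes/UpperNonSurjFive/R2-CENSUS-cruxlead-g2.md`, all `25 ∣ #Ш_an`) · C_tam 0.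

HONEST FRAMING.  Re-plumbing of landed theorems; the three cores are U5 VERBATIM on sub-loci and stay open research (exceptional zero at small image ∕
exponent-`≥ 1` Euler-system bound at image `N(C_s)`, `5S4` — barrier `EulerSystemBigImageAtSmallImage` ∕ a level-lowering congruence modulo `p²`); class-wide
all three follow from Greenberg's analytic `μ = 0` on the hard locus (`threeCores_of_muAnHardFive_of_nineFacts`, companion module).  The leaf `ClassX11a` is not
closed; no statement of the summit is proved; BSD is not proved by any of this and nothing here bounds a non-trivial `Ш`.  «beyond-print theorem: NO».

References: [Kato2004Asterisque] Thm. 12.4 (p. 221), §17.13 (pp. 279–280); [SteinWuthrich2013] Thm. 6.1 (p. 20); [Mazur1978] Cor. 4.1;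
[MazurTateTeitelbaum1986] §I.10, §I.14; [SilvermanATAEC1994] Cor. IV.9.2 (d) and Table 4.1; [Miller2011LMS] Def. 1.1 (arXiv:1010.2431 p. 3);
tree `Theorems/PrintX11aUpperNonSurjFiveShallowSector.lean`, `…TamagawaDivisibility.lean` (p674376), `…UnitSector.lean` (p671927), `…CoreResiduals.lean` (p673333).
-/

-- justified: the file namespace `Summit.BirchSwinnertonDyer.BirchSwinnertonDyer.Theorems.GL1Cartan` repeats the sub-problem segment by the D-0017 layout
set_option linter.dupNamespace false
set_option autoImplicit false

noncomputable section

open scoped Classical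

open WeierstrassCurve
  Literature.NumberTheory.EllipticCurves
  Literature.NumberTheory.EllipticCurves.ModularForms
  Literature.NumberTheory.EllipticCurves.Rank1Residual
  Literature.NumberTheory.EllipticCurves.Rank1Residual.Typed
  Literature.NumberTheory.EllipticCurves.SteinWuthrich2013
  Literature.NumberTheory.EllipticCurves.Kato2004
  Summit.BirchSwinnertonDyer.Rank1Residual
  Summit.BirchSwinnertonDyer.BirchSwinnertonDyer.Theses

namespace Summit.BirchSwinnertonDyer.BirchSwinnertonDyer.Theorems.GL1Cartan

/-! ## §1 Glue BY NAME -/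

/-- **Glue (fact-free; rev 10 of the record): UNIT → SHALLOW → C_exc → C_exp → C_tam ⟹ U5 BY NAME** — the by-name twin of
`missingUpperBoundAt_of_unitSector_of_shallow_of_threeCores` (case split on «`p` split», «unit value», «`Ш(E)[p] = 0`», «`ord_p ∏ c ≤ 1`»).
[cite: Miller2011LMS, Def. 1.1 (arXiv:1010.2431 p. 3)] [cite: SilvermanATAEC1994, Cor. IV.9.2 (d)] -/
theorem upperNonSurjFive_of_unitSector_of_shallow_of_threeCores
    (hU : ∀ (W : WeierstrassCurve ℚ) [W.IsElliptic] [W.IsGloballyMinimal] (p : ℕ) [Fact p.Prime],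
      ClassX11a W p → ¬ Surj W p → 5 ≤ p → ¬ W.HasSplitMultiplicativeReductionAtPrime p →
      (∃ t : ℚ, W.entireLFunction 1 / (W.realPeriodRat : ℂ) = (t : ℂ) ∧ padicValRat p t = 0) →
      MissingUpperBoundAt W p)
    (hS : ∀ (W : WeierstrassCurve ℚ) [W.IsElliptic] [W.IsGloballyMinimal] (p : ℕ) [Fact p.Prime],
      ClassX11a W p → ¬ Surj W p → 5 ≤ p → ¬ W.HasSplitMultiplicativeReductionAtPrime p →
      padicValNat p W.tamagawaProduct ≤ 1 → (∀ x : W.sha, (p : ℤ) • x = 0 → x = 0) → MissingUpperBoundAt W p)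
    (hCe : ∀ (W : WeierstrassCurve ℚ) [W.IsElliptic] [W.IsGloballyMinimal] (p : ℕ) [Fact p.Prime],
      ClassX11a W p → ¬ Surj W p → 5 ≤ p → W.HasSplitMultiplicativeReductionAtPrime p → MissingUpperBoundAt W p)
    (hCx : ∀ (W : WeierstrassCurve ℚ) [W.IsElliptic] [W.IsGloballyMinimal] (p : ℕ) [Fact p.Prime],
      ClassX11a W p → ¬ Surj W p → 5 ≤ p → ¬ W.HasSplitMultiplicativeReductionAtPrime p →
      (∃ x : W.sha, (p : ℤ) • x = 0 ∧ x ≠ 0) →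
      (∀ t : ℚ, W.entireLFunction 1 / (W.realPeriodRat : ℂ) = (t : ℂ) → padicValRat p t ≠ 0) →
      MissingUpperBoundAt W p)
    (hCt : ∀ (W : WeierstrassCurve ℚ) [W.IsElliptic] [W.IsGloballyMinimal] (p : ℕ) [Fact p.Prime],
      ClassX11a W p → ¬ Surj W p → 5 ≤ p → ¬ W.HasSplitMultiplicativeReductionAtPrime p →
      2 ≤ padicValNat p W.tamagawaProduct → (∀ x : W.sha, (p : ℤ) • x = 0 → x = 0) →
      (∀ t : ℚ, W.entireLFunction 1 / (W.realPeriodRat : ℂ) = (t : ℂ) → padicValRat p t ≠ 0) →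
      MissingUpperBoundAt W p) :
    PrintX11a.UpperNonSurjFive :=
  fun W _ _ p _ hX hns hp5 =>
    missingUpperBoundAt_of_unitSector_of_shallow_of_threeCores hU hS hCe hCx hCt W p hX hns hp5

/-- **Glue with the nine facts inlined (CONDITIONAL): eight facts + GZK → C_exc → C_exp → C_tam ⟹ U5 BY NAME** — UNIT from
`upperNonSurjFive_on_unitSector_of_eightFacts` (p671927), SHALLOW from `upperNonSurjFive_on_shallowSector_of_nineFacts`.  A PLANNER TURNKEY for a glued
split of item 20614 into «nine named facts» + the three cores. [cite: Kato2004Asterisque, §17.13 (pp. 279–280)] [cite: Miller2011LMS, Def. 1.1] -/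
theorem upperNonSurjFive_of_nineFacts_of_threeCores
    (hJs : thm61_splitMultiplicative) (hJn : thm61_nonsplitMultiplicative)
    (h12 : Kato2004.thm12_4) (hnf : exists_isNewformOf)
    (hns' : Kato2004.exists_multDivisibilityInputs_nonsplit_contra)
    (hsp' : Kato2004.exists_multDivisibilityInputs_split_contra)
    (hfine' : Kato2004.exists_multDivisibilityInputs_fine_contra) (hMz : mazur_not_dvd_maninConstant_of_odd)
    (hGZK : rank_eq_analyticRank_of_analyticRank_le_one)
    (hCe : ∀ (W : WeierstrassCurve ℚ) [W.IsElliptic] [W.IsGloballyMinimal] (p : ℕ) [Fact p.Prime],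
      ClassX11a W p → ¬ Surj W p → 5 ≤ p → W.HasSplitMultiplicativeReductionAtPrime p → MissingUpperBoundAt W p)
    (hCx : ∀ (W : WeierstrassCurve ℚ) [W.IsElliptic] [W.IsGloballyMinimal] (p : ℕ) [Fact p.Prime],
      ClassX11a W p → ¬ Surj W p → 5 ≤ p → ¬ W.HasSplitMultiplicativeReductionAtPrime p →
      (∃ x : W.sha, (p : ℤ) • x = 0 ∧ x ≠ 0) →
      (∀ t : ℚ, W.entireLFunction 1 / (W.realPeriodRat : ℂ) = (t : ℂ) → padicValRat p t ≠ 0) →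
      MissingUpperBoundAt W p)
    (hCt : ∀ (W : WeierstrassCurve ℚ) [W.IsElliptic] [W.IsGloballyMinimal] (p : ℕ) [Fact p.Prime],
      ClassX11a W p → ¬ Surj W p → 5 ≤ p → ¬ W.HasSplitMultiplicativeReductionAtPrime p →
      2 ≤ padicValNat p W.tamagawaProduct → (∀ x : W.sha, (p : ℤ) • x = 0 → x = 0) →
      (∀ t : ℚ, W.entireLFunction 1 / (W.realPeriodRat : ℂ) = (t : ℂ) → padicValRat p t ≠ 0) →
      MissingUpperBoundAt W p) :
    PrintX11a.UpperNonSurjFive :=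
  upperNonSurjFive_of_unitSector_of_shallow_of_threeCores
    (upperNonSurjFive_on_unitSector_of_eightFacts hJs hJn h12 hnf hns' hsp' hfine' hMz)
    (upperNonSurjFive_on_shallowSector_of_nineFacts hJs hJn h12 hnf hns' hsp' hfine' hMz hGZK) hCe hCx hCt

/-! ## §2 Exactness of the rev-10 cut and equivalence with rev 9 modulo the nine facts -/

/-- **Exactness of the rev-10 cut (fact-free): U5 ↔ UNIT ∧ SHALLOW ∧ C_exc ∧ C_exp ∧ C_tam.**  Each conjunct is U5 restricted to a sub-locus; conversely §1.
A glued split of item 20614 into these five children (the first two served modulo named prints, the three cores open) is lossless.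
[cite: Miller2011LMS, Def. 1.1 (arXiv:1010.2431 p. 3)] -/
theorem upperNonSurjFive_iff_unitSector_and_shallow_and_threeCores :
    PrintX11a.UpperNonSurjFive ↔
      ((∀ (W : WeierstrassCurve ℚ) [W.IsElliptic] [W.IsGloballyMinimal] (p : ℕ) [Fact p.Prime],
          ClassX11a W p → ¬ Surj W p → 5 ≤ p → ¬ W.HasSplitMultiplicativeReductionAtPrime p →
          (∃ t : ℚ, W.entireLFunction 1 / (W.realPeriodRat : ℂ) = (t : ℂ) ∧ padicValRat p t = 0) →
          MissingUpperBoundAt W p) ∧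
        (∀ (W : WeierstrassCurve ℚ) [W.IsElliptic] [W.IsGloballyMinimal] (p : ℕ) [Fact p.Prime],
          ClassX11a W p → ¬ Surj W p → 5 ≤ p → ¬ W.HasSplitMultiplicativeReductionAtPrime p →
          padicValNat p W.tamagawaProduct ≤ 1 → (∀ x : W.sha, (p : ℤ) • x = 0 → x = 0) → MissingUpperBoundAt W p) ∧
        (∀ (W : WeierstrassCurve ℚ) [W.IsElliptic] [W.IsGloballyMinimal] (p : ℕ) [Fact p.Prime],
          ClassX11a W p → ¬ Surj W p → 5 ≤ p → W.HasSplitMultiplicativeReductionAtPrime p → MissingUpperBoundAt W p) ∧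
        (∀ (W : WeierstrassCurve ℚ) [W.IsElliptic] [W.IsGloballyMinimal] (p : ℕ) [Fact p.Prime],
          ClassX11a W p → ¬ Surj W p → 5 ≤ p → ¬ W.HasSplitMultiplicativeReductionAtPrime p →
          (∃ x : W.sha, (p : ℤ) • x = 0 ∧ x ≠ 0) →
          (∀ t : ℚ, W.entireLFunction 1 / (W.realPeriodRat : ℂ) = (t : ℂ) → padicValRat p t ≠ 0) →
          MissingUpperBoundAt W p) ∧
        (∀ (W : WeierstrassCurve ℚ) [W.IsElliptic] [W.IsGloballyMinimal] (p : ℕ) [Fact p.Prime],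
          ClassX11a W p → ¬ Surj W p → 5 ≤ p → ¬ W.HasSplitMultiplicativeReductionAtPrime p →
          2 ≤ padicValNat p W.tamagawaProduct → (∀ x : W.sha, (p : ℤ) • x = 0 → x = 0) →
          (∀ t : ℚ, W.entireLFunction 1 / (W.realPeriodRat : ℂ) = (t : ℂ) → padicValRat p t ≠ 0) →
          MissingUpperBoundAt W p)) :=
  ⟨fun h => ⟨fun W _ _ p _ hX hns hp5 _ _ => h W p hX hns hp5, fun W _ _ p _ hX hns hp5 _ _ _ => h W p hX hns hp5,
      fun W _ _ p _ hX hns hp5 _ => h W p hX hns hp5, fun W _ _ p _ hX hns hp5 _ _ _ => h W p hX hns hp5,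
      fun W _ _ p _ hX hns hp5 _ _ _ _ => h W p hX hns hp5⟩,
    fun h => upperNonSurjFive_of_unitSector_of_shallow_of_threeCores h.1 h.2.1 h.2.2.1 h.2.2.2.1 h.2.2.2.2⟩

/-- **Rev 10 ⇒ rev 9 modulo the nine facts:** the three cores give U5 (`upperNonSurjFive_of_nineFacts_of_threeCores`), whence rev 9's non-unit cores R′♭ ∕ R₁′♭ by
restriction.  Together with the fact-free converse `threeCores_of_coreResiduals` (companion module): the rev-9 and rev-10 cuts are EQUIVALENT modulo the named
prints, and rev 10's proved part is strictly larger (the depth-one Tamagawa pairs with `Ш(E)[p] = 0`). [cite: Kato2004Asterisque, §17.13 (pp. 279–280)]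
[cite: Miller2011LMS, Def. 1.1] -/
theorem coreResiduals_of_nineFacts_of_threeCores
    (hJs : thm61_splitMultiplicative) (hJn : thm61_nonsplitMultiplicative)
    (h12 : Kato2004.thm12_4) (hnf : exists_isNewformOf)
    (hns' : Kato2004.exists_multDivisibilityInputs_nonsplit_contra)
    (hsp' : Kato2004.exists_multDivisibilityInputs_split_contra)
    (hfine' : Kato2004.exists_multDivisibilityInputs_fine_contra) (hMz : mazur_not_dvd_maninConstant_of_odd)
    (hGZK : rank_eq_analyticRank_of_analyticRank_le_one)
    (hCe : ∀ (W : WeierstrassCurve ℚ) [W.IsElliptic] [W.IsGloballyMinimal] (p : ℕ) [Fact p.Prime],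
      ClassX11a W p → ¬ Surj W p → 5 ≤ p → W.HasSplitMultiplicativeReductionAtPrime p → MissingUpperBoundAt W p)
    (hCx : ∀ (W : WeierstrassCurve ℚ) [W.IsElliptic] [W.IsGloballyMinimal] (p : ℕ) [Fact p.Prime],
      ClassX11a W p → ¬ Surj W p → 5 ≤ p → ¬ W.HasSplitMultiplicativeReductionAtPrime p →
      (∃ x : W.sha, (p : ℤ) • x = 0 ∧ x ≠ 0) →
      (∀ t : ℚ, W.entireLFunction 1 / (W.realPeriodRat : ℂ) = (t : ℂ) → padicValRat p t ≠ 0) →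
      MissingUpperBoundAt W p)
    (hCt : ∀ (W : WeierstrassCurve ℚ) [W.IsElliptic] [W.IsGloballyMinimal] (p : ℕ) [Fact p.Prime],
      ClassX11a W p → ¬ Surj W p → 5 ≤ p → ¬ W.HasSplitMultiplicativeReductionAtPrime p →
      2 ≤ padicValNat p W.tamagawaProduct → (∀ x : W.sha, (p : ℤ) • x = 0 → x = 0) →
      (∀ t : ℚ, W.entireLFunction 1 / (W.realPeriodRat : ℂ) = (t : ℂ) → padicValRat p t ≠ 0) →
      MissingUpperBoundAt W p) :
    (∀ (W : WeierstrassCurve ℚ) [W.IsElliptic] [W.IsGloballyMinimal] (p : ℕ) [Fact p.Prime],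
        ClassX11a W p → ¬ Surj W p → 5 ≤ p → (∀ (ℓ : ℕ) [Fact ℓ.Prime], ¬ W.HasSplitMultiplicativeReductionAtPrime ℓ) →
        (∃ x : W.sha, (p : ℤ) • x = 0 ∧ x ≠ 0) →
        (∀ t : ℚ, W.entireLFunction 1 / (W.realPeriodRat : ℂ) = (t : ℂ) → padicValRat p t ≠ 0) →
        MissingUpperBoundAt W p) ∧
      (∀ (W : WeierstrassCurve ℚ) [W.IsElliptic] [W.IsGloballyMinimal] (p : ℕ) [Fact p.Prime],
        ClassX11a W p → ¬ Surj W p → 5 ≤ p →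
        (∃ (ℓ : ℕ) (_ : Fact ℓ.Prime), W.HasSplitMultiplicativeReductionAtPrime ℓ) →
        (W.HasSplitMultiplicativeReductionAtPrime p ∨
          ∀ t : ℚ, W.entireLFunction 1 / (W.realPeriodRat : ℂ) = (t : ℂ) → padicValRat p t ≠ 0) →
        MissingUpperBoundAt W p) :=
  have h := upperNonSurjFive_of_nineFacts_of_threeCores hJs hJn h12 hnf hns' hsp' hfine' hMz hGZK hCe hCx hCt
  ⟨fun W _ _ p _ hX hns hp5 _ _ _ => h W p hX hns hp5, fun W _ _ p _ hX hns hp5 _ _ => h W p hX hns hp5⟩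

end Summit.BirchSwinnertonDyer.BirchSwinnertonDyer.Theorems.GL1Cartan

end
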